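import Mathlib
import Summits.Ventures.FusionMHD.Models.CerfonFreidbergIterLikeQHalfShearDefs
import HarnessLib

/-!
# Ventures/FusionMHD — Models/CerfonFreidbergIterLikeQHalfShearPanels8.lean: KERNEL CHECK of the shear-register certificates of panels 14, 15 (of 32)
# at `ψ_N = 1/2` of THE Cerfon–Freidberg ITER-like instance

HONEST FRAMING (LADDER-GRIDFUSION three columns; CF rung; successor step of «q′(ψ_N = 1/2) on the CF rung», F2-SCOPING v1.6 §10(c)).  One `decide +kernel`
(≈ 80 s): for each listed panel the obligation `CFIterLike.QHalfShear.ShearCert.ok` (`Models/CerfonFreidbergIterLikeQHalfShearDefs.lean`) — the Taylor-model run of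
`progQ = CFIterLike.QHalf.progA ++ blockQ` over ★ #117's parameter box is ACCEPTED and the kernel's panel-integral enclosure of the shear kernel `K·p` along the
approximant lies inside the claimed integers (read off a compiled `#eval` of the same functions, slack one unit of `2⁻⁶⁰`; float truth inside every panel).
MODELLED: analytic Cerfon–Freidberg family; nothing about a device or stability.  No `native_decide`.  Typer/prover: gridfusion-model-5 (g8), 2026-08-27.
Citations: Freidberg 2014 §6.3.5 (6.35) [Freidberg2014]; Mahboubi–Melquiond–Sibut-Pinote 2016 §3.2 Lemma 3 [MahboubiMelquiondSibutpinote2016].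
-/

namespace Summit.Ventures.FusionMHD.Models.CFIterLike.QHalfShear

/-- Shear-register certificate data of panels 14, 15. [instance data] -/
def shearCert8 : List ShearCert := [
  { j := 14, cand := [552442246874651951104, 5298541242292801372160, 34114803959202697969664, 146720158803837505765376, 286909467647060329103360, -1638340804391549284646912, -20706203589769295713796096, -119734608979638507716739072, -390394662404755867836612608, 81500829089550979454468096, 4995393135965434927504162816, 58756331196329910735860662272, 7074315136866487487986032181248],
    deg := 10, elog2 := 44, plo := -1267532975789415685, phi := -1267532786255829192 },
  { j := 15, cand := [756016123241661988864, 7883201681001134686208, 48670233196155570749440, 149351767544392641937408, -423224223601512337637376, -8517055133192140953223168, -53955699459799820321947648, -144098086128004147192004608, 639478656953182747017347072, 9578539874764844894680776704, 49943444497343618332154134528, 92501386106842351610072399872, 1813879664420299125183903432704],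
    deg := 10, elog2 := 44, plo := -385510626145681055, phi := -385510497595048510 }]

/-- **KERNEL CHECK** of the shear register on panels 14, 15. -/
theorem shearCert8_ok : CFIterLike.QHalfShear.shearCert8.all ShearCert.ok = true := by
  decide +kernel

end Summit.Ventures.FusionMHD.Models.CFIterLike.QHalfShear
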